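import Literature.NumberTheory.LFunctions.PrimeIdealChebyshev
import Literature.NumberTheory.LFunctions.LogIntegralOffsetProofs
import Literature.NumberTheory.LFunctions.LogIntegralStrictMonoProofs
import Mathlib.Analysis.Calculus.MeanValue
import HarnessLib

/-!
# Partial summation with an exceptional-zero term: from `θ`-type to `π`-type asymptotics

Topic `Literature/NumberTheory/LFunctions` (namespace `Literature.NumberTheory.LFunctions`).
Everything in this file is PROVED (theorems only; no definitions, no named facts).

This is the last, elementary, step of the proof of Thorner–Zaman's uniform Chebotarev / prime
ideal theorem with the Landau–Siegel term [ThornerZaman2019, Thm. 1.4, proof of Thm. 5.1,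
eq. (5.2)]: if a Chebyshev-type function `T` (there `ψ_C`, here any nonnegative `T ≤ B·t`, e.g.
the tree's `θ_C = chebyshevThetaIdealClass`) satisfies
`T(t) = h⁻¹ (t − θ₁ t^β/β)(1 + O(E(t)))` for `t ≥ y`, then the counting function
`P(x) = T(x)/log x + ∫₂ˣ T(t) dt/(t log² t)` (partial summation, the tree's
`primeIdealClassCount_eq_theta_div_log_add_integral`) satisfies
`P(x) = h⁻¹ (Li(x) − θ₁ Li(x^β))(1 + O(E(√x))) + O((B + h⁻¹)√x)` for `x ≥ max(64, y²)`, with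
absolute constants.  The key identity is the printed (5.2),
`x^σ/(σ log x) + ∫ t^{σ−1}/(σ log² t) dt = Li(x^σ) + O(1)`, here in the exact form
`secondaryTerm_eq_offsetLogIntegral_add` (the `O(1)` is the constant
`2^σ/(σ log 2) − Li(2^σ) ∈ [0, 9]`, `secondaryTerm_const_nonneg`/`_le`), proved by
differentiating in `x`; the main-term identity `x/log x + ∫₂ˣ dt/log² t = Li(x) + 2/log 2` is
the tree's `offsetLogIntegral_eq_div_log_add_integral`.

## References

* J. Thorner, A. Zaman, *A unified and improved Chebotarev density theorem*, Algebra Number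
  Theory 13 (2019) 1039–1068, §5.1, proof of Theorem 5.1, (5.2)–(5.3). [ThornerZaman2019]
* H. L. Montgomery, R. C. Vaughan, *Multiplicative Number Theory I*, CUP 2007, Cor. 11.17 and
  the passage from `ψ(x; q, a)` to `π(x; q, a)` (the same step over `ℚ`). [MontgomeryVaughan2007]
-/

noncomputable section

open Real MeasureTheory Set Filter
open scoped Topology

namespace Literature.NumberTheory.LFunctions

/-! ### Elementary integrals -/

/-- `∫ₐᵇ dt/log² t ≤ (b − a)/log² a` for `1 < a ≤ b` (the integrand is decreasing).
[folklore] -/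
theorem integral_one_div_log_sq_le {a b : ℝ} (ha : 1 < a) (hab : a ≤ b) :
    ∫ t in a..b, 1 / Real.log t ^ 2 ≤ (b - a) / Real.log a ^ 2 := by
  have hla : 0 < Real.log a := Real.log_pos ha
  calc ∫ t in a..b, 1 / Real.log t ^ 2 ≤ ∫ _ in a..b, 1 / Real.log a ^ 2 := by
        refine intervalIntegral.integral_mono_on hab
          (Chebyshev.intervalIntegrable_one_div_log_sq ha (by linarith)) (by simp) fun t ht ↦ ?_
        have hlt : Real.log a ≤ Real.log t := Real.log_le_log (by linarith) ht.1
        exact one_div_le_one_div_of_le (by positivity) (pow_le_pow_left₀ hla.le hlt 2)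
    _ = (b - a) / Real.log a ^ 2 := by
        rw [intervalIntegral.integral_const, smul_eq_mul]
        ring

/-! ### The secondary term: `x^β/(β log x) + ∫₂ˣ t^β/β dt/(t log² t) = Li(x^β) + κ_β` -/

/-- Continuity of the secondary integrand `t ↦ t^β/β/(t log² t)` at `t > 1`. [folklore] -/
theorem continuousAt_secondaryIntegrand (β : ℝ) {t : ℝ} (ht : 1 < t) :
    ContinuousAt (fun u : ℝ ↦ u ^ β / β / (u * Real.log u ^ 2)) t := by
  have ht0 : t ≠ 0 := by linarith
  have hlog : Real.log t ≠ 0 := Real.log_ne_zero_of_pos_of_ne_one (by linarith) (by linarith)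
  have h1 : ContinuousAt (fun u : ℝ ↦ u ^ β) t := Real.continuousAt_rpow_const _ _ (Or.inl ht0)
  have h2 : ContinuousAt (fun u : ℝ ↦ u * Real.log u ^ 2) t :=
    continuousAt_id.mul ((Real.continuousAt_log ht0).pow 2)
  exact (h1.div_const β).div h2 (mul_ne_zero ht0 (pow_ne_zero _ hlog))

/-- The secondary integrand is continuous on `(1, ∞)`. [folklore] -/
theorem continuousOn_secondaryIntegrand (β : ℝ) :
    ContinuousOn (fun u : ℝ ↦ u ^ β / β / (u * Real.log u ^ 2)) (Ioi 1) :=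
  fun _ ht ↦ (continuousAt_secondaryIntegrand β ht).continuousWithinAt

/-- Interval integrability of the secondary integrand between points of `(1, ∞)`. [folklore] -/
theorem intervalIntegrable_secondaryIntegrand (β : ℝ) {a b : ℝ} (ha : 1 < a) (hb : 1 < b) :
    IntervalIntegrable (fun u : ℝ ↦ u ^ β / β / (u * Real.log u ^ 2)) volume a b := by
  refine ContinuousOn.intervalIntegrable fun t ht ↦
    (continuousAt_secondaryIntegrand β ?_).continuousWithinAt
  rcases Set.mem_uIcc.mp ht with h | h <;> linarith [h.1]

/-- Derivative of `u ↦ u^β/(β log u)` at `u > 1` (quotient rule), in raw form. [folklore] -/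
theorem hasDerivAt_rpow_div_mul_log {β : ℝ} (hβ : β ≠ 0) {y : ℝ} (hy : 1 < y) :
    HasDerivAt (fun u : ℝ ↦ u ^ β / (β * Real.log u))
      ((β * y ^ (β - 1) * (β * Real.log y) - y ^ β * (β * y⁻¹)) / (β * Real.log y) ^ 2) y := by
  have hy0 : y ≠ 0 := by linarith
  have hlog : Real.log y ≠ 0 := Real.log_ne_zero_of_pos_of_ne_one (by linarith) (by linarith)
  have hf : HasDerivAt (fun u : ℝ ↦ u ^ β) (β * y ^ (β - 1)) y :=
    Real.hasDerivAt_rpow_const (Or.inl hy0)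
  have hk : HasDerivAt (fun u : ℝ ↦ β * Real.log u) (β * y⁻¹) y :=
    (Real.hasDerivAt_log hy0).const_mul β
  exact hf.div hk (mul_ne_zero hβ hlog)

/-- **The secondary-term function is constant**: with
`Φ(u) = u^β/(β log u) + ∫₂ᵘ t^β/β dt/(t log² t) − Li(u^β)`, `Φ' = 0` on `(1, ∞)` (the three
derivatives `u^{β−1}/log u − u^{β−1}/(β log² u)`, `u^{β−1}/(β log² u)` and
`β u^{β−1}/log(u^β) = u^{β−1}/log u` cancel), for `β > 0`. [cite: ThornerZaman2019, (5.2)] -/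
theorem hasDerivAt_secondaryTerm_zero {β : ℝ} (hβ : 0 < β) {y : ℝ} (hy : 1 < y) :
    HasDerivAt (fun u : ℝ ↦ u ^ β / (β * Real.log u) +
        (∫ t in (2 : ℝ)..u, t ^ β / β / (t * Real.log t ^ 2)) - offsetLogIntegral (u ^ β)) 0 y := by
  have hy0 : y ≠ 0 := by linarith
  have hypos : 0 < y := by linarith
  have hlog : Real.log y ≠ 0 := Real.log_ne_zero_of_pos_of_ne_one hypos (by linarith)
  have h1 := hasDerivAt_rpow_div_mul_log hβ.ne' hy
  have h2 : HasDerivAt (fun u : ℝ ↦ ∫ t in (2 : ℝ)..u, t ^ β / β / (t * Real.log t ^ 2))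
      (y ^ β / β / (y * Real.log y ^ 2)) y :=
    intervalIntegral.integral_hasDerivAt_right
      (intervalIntegrable_secondaryIntegrand β one_lt_two hy)
      (ContinuousOn.stronglyMeasurableAtFilter isOpen_Ioi (continuousOn_secondaryIntegrand β) y hy)
      (continuousAt_secondaryIntegrand β hy)
  have hyβ : 1 < y ^ β := Real.one_lt_rpow hy hβ
  have hLi : HasDerivAt offsetLogIntegral (Real.log (y ^ β))⁻¹ (y ^ β) :=
    hasDerivAt_offsetLogIntegral_holds hyβ
  have h3 := hLi.comp y (Real.hasDerivAt_rpow_const (p := β) (Or.inl hy0))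
  refine ((h1.add h2).sub h3).congr_deriv ?_
  rw [Real.log_rpow hypos, Real.rpow_sub_one hy0]
  field_simp
  ring

/-- **Thorner–Zaman (5.2), exact form**: for `0 < β` and `x ≥ 2`,
`x^β/(β log x) + ∫₂ˣ t^β/β dt/(t log² t) = Li(x^β) + κ_β` with the constant
`κ_β = 2^β/(β log 2) − Li(2^β)` (printed: `= Li(x^σ) + O(x^{1/2}/log x)` for the integral from
`√x`; here from `2`, with an `O(1)`). [cite: ThornerZaman2019, (5.2)] -/
theorem secondaryTerm_eq_offsetLogIntegral_add {β : ℝ} (hβ : 0 < β) {x : ℝ} (hx : 2 ≤ x) :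
    x ^ β / (β * Real.log x) + ∫ t in (2 : ℝ)..x, t ^ β / β / (t * Real.log t ^ 2) =
      offsetLogIntegral (x ^ β) + (2 ^ β / (β * Real.log 2) - offsetLogIntegral (2 ^ β)) := by
  set Φ : ℝ → ℝ := fun u ↦ u ^ β / (β * Real.log u) +
      (∫ t in (2 : ℝ)..u, t ^ β / β / (t * Real.log t ^ 2)) - offsetLogIntegral (u ^ β) with hΦ
  have hderiv : ∀ u ∈ Ico 2 x, HasDerivWithinAt Φ 0 (Ici u) u := fun u hu ↦
    (hasDerivAt_secondaryTerm_zero hβ (by linarith [hu.1])).hasDerivWithinAt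
  have hcont : ContinuousOn Φ (Icc 2 x) := fun u hu ↦
    (hasDerivAt_secondaryTerm_zero hβ (by linarith [hu.1])).continuousAt.continuousWithinAt
  have h := constant_of_has_deriv_right_zero hcont hderiv x ⟨hx, le_rfl⟩
  simp only [hΦ, intervalIntegral.integral_same, add_zero] at h
  linarith

/-- `1 < 2^β ≤ 2` for `0 < β ≤ 1`. [folklore] -/
theorem one_lt_two_rpow_and_le {β : ℝ} (hβ : 0 < β) (hβ1 : β ≤ 1) :
    1 < (2 : ℝ) ^ β ∧ (2 : ℝ) ^ β ≤ 2 := by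
  refine ⟨Real.one_lt_rpow one_lt_two hβ, ?_⟩
  calc (2 : ℝ) ^ β ≤ (2 : ℝ) ^ (1 : ℝ) := Real.rpow_le_rpow_of_exponent_le one_le_two hβ1
    _ = 2 := Real.rpow_one 2

/-- `Li(2^β) = −∫_{2^β}^2 dt/log t` for `0 < β`. [folklore] -/
theorem offsetLogIntegral_two_rpow {β : ℝ} (hβ : 0 < β) :
    offsetLogIntegral ((2 : ℝ) ^ β) = -∫ t in (2 : ℝ) ^ β..2, (Real.log t)⁻¹ := by
  have h := offsetLogIntegral_sub_offsetLogIntegral (Real.one_lt_rpow one_lt_two hβ) one_lt_two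
  rw [offsetLogIntegral_two] at h
  linarith

/-- **The constant `κ_β = 2^β/(β log 2) − Li(2^β)` is nonnegative** (`Li(2^β) ≤ 0` as
`2^β ≤ 2`), for `0 < β ≤ 1`. [folklore] -/
theorem secondaryTerm_const_nonneg {β : ℝ} (hβ : 0 < β) (hβ1 : β ≤ 1) :
    0 ≤ (2 : ℝ) ^ β / (β * Real.log 2) - offsetLogIntegral ((2 : ℝ) ^ β) := by
  obtain ⟨h1, h2⟩ := one_lt_two_rpow_and_le hβ hβ1
  have hl2 : 0 < Real.log 2 := Real.log_pos one_lt_two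
  have hint : 0 ≤ ∫ t in (2 : ℝ) ^ β..2, (Real.log t)⁻¹ :=
    intervalIntegral.integral_nonneg h2 fun t ht ↦
      inv_nonneg.mpr (Real.log_nonneg (by linarith [ht.1]))
  rw [offsetLogIntegral_two_rpow hβ]
  have : 0 ≤ (2 : ℝ) ^ β / (β * Real.log 2) := by positivity
  linarith

/-- **`κ_β ≤ 9`** for `1/2 < β ≤ 1`: `2^β/(β log 2) ≤ 4/log 2 < 6` and
`−Li(2^β) = ∫_{2^β}^2 dt/log t ≤ 1 · (β log 2)⁻¹ < 3`. [folklore] -/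
theorem secondaryTerm_const_le {β : ℝ} (hβ : 1 / 2 < β) (hβ1 : β ≤ 1) :
    (2 : ℝ) ^ β / (β * Real.log 2) - offsetLogIntegral ((2 : ℝ) ^ β) ≤ 9 := by
  have hβ0 : 0 < β := by linarith
  obtain ⟨h1, h2⟩ := one_lt_two_rpow_and_le hβ0 hβ1
  have hlog2 : (0.6931471803 : ℝ) < Real.log 2 := Real.log_two_gt_d9
  have hl2 : 0 < Real.log 2 := by linarith
  have hβl : 1 / 4 < β * Real.log 2 := by nlinarith
  -- the boundary constant
  have hA : (2 : ℝ) ^ β / (β * Real.log 2) ≤ 6 := by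
    rw [div_le_iff₀ (by positivity)]
    nlinarith
  -- the integral
  have hlogt : ∀ t ∈ Icc ((2 : ℝ) ^ β) 2, (Real.log t)⁻¹ ≤ (β * Real.log 2)⁻¹ := by
    intro t ht
    have hlt : Real.log ((2 : ℝ) ^ β) ≤ Real.log t := Real.log_le_log (by linarith) ht.1
    rw [Real.log_rpow two_pos] at hlt
    exact inv_anti₀ (by positivity) hlt
  have hB : ∫ t in (2 : ℝ) ^ β..2, (Real.log t)⁻¹ ≤ 3 := by
    calc ∫ t in (2 : ℝ) ^ β..2, (Real.log t)⁻¹ ≤ ∫ _ in (2 : ℝ) ^ β..2, (β * Real.log 2)⁻¹ :=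
          intervalIntegral.integral_mono_on h2
            (by simpa using intervalIntegrable_inv_log_pow 1 h1 one_lt_two) (by simp) hlogt
      _ = (2 - (2 : ℝ) ^ β) * (β * Real.log 2)⁻¹ := by
          rw [intervalIntegral.integral_const, smul_eq_mul]
      _ ≤ 1 * (β * Real.log 2)⁻¹ :=
          mul_le_mul_of_nonneg_right (by linarith) (by positivity)
      _ ≤ 3 := by
          rw [one_mul]
          calc (β * Real.log 2)⁻¹ ≤ (0.34 : ℝ)⁻¹ := inv_anti₀ (by norm_num) (by nlinarith)
            _ ≤ 3 := by norm_num
  rw [offsetLogIntegral_two_rpow hβ0]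
  linarith

/-! ### Elementary inequalities for the main terms `g(t) = t − θ₁ t^β/β`, `G(x) = Li(x) − θ₁ Li(x^β)` -/

/-- **`Li(x) ≥ x/(2 log x)` for `x ≥ 256`** (`Li(x) = x/log x − 2/log 2 + ∫₂ˣ dt/log² t ≥ x/log x − 3`
and `x ≥ 6 log x`). [folklore] -/
theorem div_two_mul_log_le_offsetLogIntegral {x : ℝ} (hx : 256 ≤ x) :
    x / (2 * Real.log x) ≤ offsetLogIntegral x := by
  have hx2 : (2 : ℝ) ≤ x := by linarith
  have hL : 0 < Real.log x := Real.log_pos (by linarith)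
  have hlog2 : (0.6931471803 : ℝ) < Real.log 2 := Real.log_two_gt_d9
  have hint : 0 ≤ ∫ t in (2 : ℝ)..x, 1 / Real.log t ^ 2 :=
    intervalIntegral.integral_nonneg hx2 fun t _ ↦ by positivity
  have h16 : 16 ≤ Real.sqrt x := by
    rw [show (16 : ℝ) = Real.sqrt 256 by
      rw [show (256 : ℝ) = 16 ^ 2 by norm_num, Real.sqrt_sq (by norm_num)]]
    exact Real.sqrt_le_sqrt hx
  have hsq : Real.sqrt x * Real.sqrt x = x := Real.mul_self_sqrt (by linarith)
  have hlogx : Real.log x ≤ 2 * Real.sqrt x := by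
    -- `log x ≤ x^{1/2}/(1/2)` (Mathlib `Real.log_le_rpow_div`; cf. the tree's
    -- `Literature.NumberTheory.Sieve.DFI1995.log_le_two_mul_sqrt`, not imported here)
    have h := Real.log_le_rpow_div (by linarith : (0 : ℝ) ≤ x) (by norm_num : (0 : ℝ) < 1 / 2)
    rw [Real.sqrt_eq_rpow]
    linarith
  have h6 : 6 * Real.log x ≤ x := by nlinarith
  have h22 : 2 / Real.log 2 ≤ 3 := by
    rw [div_le_iff₀ (by linarith)]
    linarith
  rw [NumberField.offsetLogIntegral_eq_div_log_add_integral hx2]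
  have h3 : x / (2 * Real.log x) + 3 ≤ x / Real.log x := by
    rw [div_add' _ _ _ (by positivity), div_le_div_iff₀ (by positivity) hL]
    nlinarith
  linarith

/-- `Li(x) − Li(x^β) ≥ (x − x^β)/log x` for `x > 1`, `0 < β ≤ 1` (the integrand of
`∫_{x^β}^x dt/log t` is at least `1/log x`). [folklore] -/
theorem sub_rpow_div_log_le_offsetLogIntegral_sub {x β : ℝ} (hx : 1 < x) (hβ : 0 < β) (hβ1 : β ≤ 1) :
    (x - x ^ β) / Real.log x ≤ offsetLogIntegral x - offsetLogIntegral (x ^ β) := by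
  have hxβ : 1 < x ^ β := Real.one_lt_rpow hx hβ
  have hxβx : x ^ β ≤ x := by
    calc x ^ β ≤ x ^ (1 : ℝ) := Real.rpow_le_rpow_of_exponent_le hx.le hβ1
      _ = x := Real.rpow_one x
  have hL : 0 < Real.log x := Real.log_pos hx
  rw [offsetLogIntegral_sub_offsetLogIntegral hxβ hx]
  calc (x - x ^ β) / Real.log x = ∫ _ in x ^ β..x, (Real.log x)⁻¹ := by
        rw [intervalIntegral.integral_const, smul_eq_mul, div_eq_mul_inv]
    _ ≤ ∫ t in x ^ β..x, (Real.log t)⁻¹ := by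
        refine intervalIntegral.integral_mono_on hxβx (by simp)
          (by simpa using intervalIntegrable_inv_log_pow 1 hxβ hx) fun t ht ↦ ?_
        have ht1 : 1 < t := by linarith [ht.1]
        exact inv_anti₀ (Real.log_pos ht1) (Real.log_le_log (by linarith) ht.2)

/-- For `t ≥ 8` and `1/2 < β ≤ 1`: `t^β ≤ β t` (as `β t^{1−β} ≥ β e^{2(1−β)} ≥ β(3 − 2β) ≥ 1`).
[folklore] -/
theorem rpow_le_mul_self_of_eight_le {β t : ℝ} (hβ : 1 / 2 < β) (hβ1 : β ≤ 1) (ht : 8 ≤ t) :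
    t ^ β ≤ β * t := by
  have ht0 : 0 < t := by linarith
  have hlogt : 2 ≤ Real.log t := by
    rw [Real.le_log_iff_exp_le ht0]
    have he : Real.exp 1 < 2.7182818286 := Real.exp_one_lt_d9
    have h2 : Real.exp 2 = Real.exp 1 * Real.exp 1 := by rw [← Real.exp_add]; norm_num
    nlinarith [Real.exp_pos 1]
  have h1 : t = t ^ β * t ^ (1 - β) := by
    rw [← Real.rpow_add ht0, add_sub_cancel, Real.rpow_one]
  have h2 : 1 + 2 * (1 - β) ≤ t ^ (1 - β) := by
    rw [Real.rpow_def_of_pos ht0]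
    refine le_trans ?_ (Real.add_one_le_exp _)
    nlinarith
  have h3 : 1 ≤ β * t ^ (1 - β) := by nlinarith
  have h4 : 0 < t ^ β := Real.rpow_pos_of_pos ht0 β
  calc t ^ β = t ^ β * 1 := (mul_one _).symm
    _ ≤ t ^ β * (β * t ^ (1 - β)) := mul_le_mul_of_nonneg_left h3 h4.le
    _ = β * t := by rw [← mul_assoc, mul_comm (t ^ β) β, mul_assoc, ← h1]

/-- **`g(t) = t − θ₁ t^β/β ≥ 0` for `t ≥ 8`**, `|θ₁| ≤ 1`, `1/2 < β ≤ 1`. [folklore] -/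
theorem exceptionalMainTerm_nonneg {θ₁ β t : ℝ} (hθ : |θ₁| ≤ 1) (hβ : 1 / 2 < β) (hβ1 : β ≤ 1)
    (ht : 8 ≤ t) : 0 ≤ t - θ₁ * t ^ β / β := by
  have hβ0 : 0 < β := by linarith
  have h4 : 0 ≤ t ^ β := Real.rpow_nonneg (by linarith) β
  have h1 : θ₁ * t ^ β / β ≤ t ^ β / β := by
    rw [div_le_div_iff_of_pos_right hβ0]
    nlinarith [(abs_le.mp hθ).2]
  have h2 : t ^ β / β ≤ t := by
    rw [div_le_iff₀ hβ0, mul_comm]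
    exact rpow_le_mul_self_of_eight_le hβ hβ1 ht
  linarith

/-- **`|g(t)| ≤ 3t`**: `|t − θ₁ t^β/β| ≤ t + t^β/β ≤ 3t` for `t ≥ 1`, `|θ₁| ≤ 1`, `1/2 < β ≤ 1`.
[folklore] -/
theorem abs_exceptionalMainTerm_le {θ₁ β t : ℝ} (hθ : |θ₁| ≤ 1) (hβ : 1 / 2 < β) (hβ1 : β ≤ 1)
    (ht : 1 ≤ t) : |t - θ₁ * t ^ β / β| ≤ 3 * t := by
  have hβ0 : 0 < β := by linarith
  have h4 : 0 ≤ t ^ β := Real.rpow_nonneg (by linarith) β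
  have htβ : t ^ β ≤ t := by
    calc t ^ β ≤ t ^ (1 : ℝ) := Real.rpow_le_rpow_of_exponent_le ht hβ1
      _ = t := Real.rpow_one t
  have h1 : |θ₁ * t ^ β / β| ≤ 2 * t := by
    rw [abs_div, abs_mul, abs_of_pos hβ0, abs_of_nonneg h4, div_le_iff₀ hβ0]
    calc |θ₁| * t ^ β ≤ 1 * t := mul_le_mul hθ htβ h4 zero_le_one
      _ ≤ 2 * t * β := by nlinarith
  calc |t - θ₁ * t ^ β / β| ≤ |t| + |θ₁ * t ^ β / β| := abs_sub _ _
    _ ≤ t + 2 * t := add_le_add (abs_of_nonneg (by linarith)).le h1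
    _ = 3 * t := by ring

/-- **Comparison of the `θ`- and `π`-main terms.** For `x ≥ 256`, `|θ₁| ≤ 1`, `1/2 < β ≤ 1`
there is `w ≥ 0` with `g(t) ≤ w t` on `[1, x]` and `x w ≤ 6 (log x) G(x)`, where
`g(t) = t − θ₁ t^β/β`, `G(x) = Li(x) − θ₁ Li(x^β)`: for `θ₁ ≥ 0` take `w = 1 − θ₁ x^{β−1}`
(`Li(x) − Li(x^β) ≥ (x − x^β)/log x`), for `θ₁ < 0` take `w = 3` (`Li(x^β) ≥ 0`).  This is the
elementary content of "`Li(x) − θ₁ Li(x^{β₁}) ≫ …`" in [ThornerZaman2019, (1.6), (4.8)].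
[cite: ThornerZaman2019, (4.8)] -/
theorem exists_exceptionalMainTerm_le {θ₁ β x : ℝ} (hθ : |θ₁| ≤ 1) (hβ : 1 / 2 < β) (hβ1 : β ≤ 1)
    (hx : 256 ≤ x) :
    ∃ w : ℝ, 0 ≤ w ∧ (∀ t ∈ Icc 1 x, t - θ₁ * t ^ β / β ≤ w * t) ∧
      x * w ≤ 6 * Real.log x * (offsetLogIntegral x - θ₁ * offsetLogIntegral (x ^ β)) := by
  have hβ0 : 0 < β := by linarith
  have hx1 : (1 : ℝ) < x := by linarith
  have hx0 : (0 : ℝ) < x := by linarith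
  have hL : 0 < Real.log x := Real.log_pos hx1
  have hLi : x / (2 * Real.log x) ≤ offsetLogIntegral x := div_two_mul_log_le_offsetLogIntegral hx
  have hLi' : x ≤ 2 * Real.log x * offsetLogIntegral x := by
    rwa [div_le_iff₀' (by positivity)] at hLi
  obtain ⟨hθl, hθu⟩ := abs_le.mp hθ
  rcases le_or_gt 0 θ₁ with h0 | h0
  · -- `θ₁ ≥ 0`: `w = 1 − θ₁ x^{β−1}`
    have hxb1 : x ^ (β - 1) ≤ 1 := Real.rpow_le_one_of_one_le_of_nonpos hx1.le (by linarith)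
    have hxb0 : 0 < x ^ (β - 1) := Real.rpow_pos_of_pos hx0 _
    refine ⟨1 - θ₁ * x ^ (β - 1), by nlinarith, fun t ht ↦ ?_, ?_⟩
    · have ht0 : 0 < t := by linarith [ht.1]
      have htb : x ^ (β - 1) ≤ t ^ (β - 1) :=
        Real.rpow_le_rpow_of_nonpos ht0 ht.2 (by linarith)
      have htβ : t ^ β = t * t ^ (β - 1) := by
        rw [Real.rpow_sub_one ht0.ne']; field_simp
      have h4 : 0 ≤ t ^ β := Real.rpow_nonneg ht0.le β
      have h1 : θ₁ * t ^ β ≤ θ₁ * t ^ β / β := by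
        rw [le_div_iff₀ hβ0]
        nlinarith [mul_nonneg (mul_nonneg h0 h4) (sub_nonneg.mpr hβ1)]
      have h2 : θ₁ * (t * x ^ (β - 1)) ≤ θ₁ * t ^ β := by
        rw [htβ]
        exact mul_le_mul_of_nonneg_left (mul_le_mul_of_nonneg_left htb ht0.le) h0
      nlinarith
    · have hsub := sub_rpow_div_log_le_offsetLogIntegral_sub hx1 hβ0 hβ1
      rw [div_le_iff₀ hL] at hsub
      have hxβ : x ^ β = x * x ^ (β - 1) := by
        rw [Real.rpow_sub_one hx0.ne']; field_simp
      -- `L·G = (1−θ₁) L·Li x + θ₁ L (Li x − Li x^β) ≥ (1−θ₁) x/2 + θ₁ (x − x^β)`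
      have hLi0 : 0 ≤ offsetLogIntegral x := by
        have := div_nonneg hx0.le (by positivity : (0 : ℝ) ≤ 2 * Real.log x); linarith
      nlinarith [mul_nonneg h0 (sub_nonneg.mpr hxb1), mul_nonneg (sub_nonneg.mpr hθu) hLi0,
        mul_nonneg (sub_nonneg.mpr hθu) hx0.le]
  · -- `θ₁ < 0`: `w = 3`
    refine ⟨3, by norm_num, fun t ht ↦ ?_, ?_⟩
    · exact (le_abs_self _).trans (abs_exceptionalMainTerm_le hθ hβ hβ1 ht.1)
    · have hxβ2 : 2 ≤ x ^ β := by
        have h16 : (16 : ℝ) ≤ x ^ β := by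
          calc (16 : ℝ) = 256 ^ (1 / 2 : ℝ) := by
                rw [show (256 : ℝ) = 16 ^ (2 : ℝ) by norm_num, ← Real.rpow_mul (by norm_num)]
                norm_num
            _ ≤ x ^ (1 / 2 : ℝ) := Real.rpow_le_rpow (by norm_num) hx (by norm_num)
            _ ≤ x ^ β := Real.rpow_le_rpow_of_exponent_le hx1.le hβ.le
        linarith
      have hLiβ : 0 ≤ offsetLogIntegral (x ^ β) := by
        have := offsetLogIntegralPow_nonneg 1 hxβ2
        rwa [offsetLogIntegralPow_one] at this
      nlinarith [mul_nonneg (neg_nonneg.mpr h0.le) hLiβ, hL]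

end Literature.NumberTheory.LFunctions

end
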